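import Literature.Analysis.FluidPDE.KNSSLineInvariantPlanar
import HarnessLib

/-!
# Bounded ancient solutions invariant along one direction, II: the §4 representative with
# constant planar components is constant in space

Analysis/FluidPDE proofs file (theorems only), second of three (after `KNSSLineInvariantPlanar`)
on the folklore corollary of Koch–Nadirashvili–Seregin–Šverák 2009 (Acta Math. 203 =
arXiv:0709.3599), Theorem 5.1 + §4 + Lemma 2.1: a bounded ancient solution of Navier–Stokes on
`ℝ³ × (−∞, 0)` invariant along one direction is constant in space on every slice.

This file treats the smooth part `U` of `u = U + b(t)` furnished by the §4 regularity fact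
`KNSS2009_regularity_boundedWeak_ancient` (derivatives bounded and Lipschitz in `t`, jointly
measurable, the time-integrated vorticity equation (4.5) `ω(t) − ω(s) = ∫ₛᵗ (Δω − Dω[U + b] + DU[ω])`):
`clm_curl_family` (norm bookkeeping for `ℓ(curl U)`, `‖ℓ‖ ≤ 1`, as `curl_apply_one_family` of
`KNSSThm52Assembly`); `clm_curl_nonpos` (**if `ℓ` kills the velocity gradient — no stretching —
and `ℓ(curl U(t)) = ∂ₑ w_t` with `w_t` bounded, then `ℓ(curl U) ≤ 0`**: `ℓ(curl U)` is in the class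
of Lemma 2.1 with drift `U + b`, the integrand of (4.5) being interval integrable by
`vorticity_integrand_intervalIntegrable`, and `directionalDeriv_nonpos_of_lemma21` applies);
`repr_const_of_planar_const` (**if `U₀, U₂` are constant in space at every `t < 0`, so is `U₁`**:
`ω = (−∂₂U₁, 0, ∂₀U₁)`, the forms `±ω₀`, `±ω₂` have no stretching and are directional derivatives
of `∓U₁`, `±U₁`, so `∂₀U₁ = ∂₂U₁ = 0`, and `∂₁U₁ = −∂₀U₀ − ∂₂U₂ = 0` by `div U = 0`).

## References

* G. Koch, N. Nadirashvili, G. Seregin, V. Šverák, *Liouville theorems for the Navier–Stokes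
  equations and applications*, Acta Math. 203 (2009) 83–105 = arXiv:0709.3599: Theorem 5.1 and
  its proof (p. 9), Lemma 2.1 (p. 5), §4 (p. 8), proof of Theorem 6.2 (p. 13).
  [KochNadirashviliSereginSverak2009]
* A. J. Majda, A. L. Bertozzi, *Vorticity and Incompressible Flow*, CUP 2002, §2.3.1
  (`2½`-dimensional flows). [MajdaBertozziCUP2002]
-/

noncomputable section

open Set Function Filter MeasureTheory Topology InnerProductSpace WithLp intervalIntegral
open scoped RealInnerProductSpace Laplacian ContDiff

namespace Literature.Analysis.FluidPDE

/-! ### The §4 representative: `ℓ ∘ curl U` in the class of Lemma 2.1 -/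

section Representative

variable {U : ℝ → (EuclideanSpace ℝ (Fin 3)) → (EuclideanSpace ℝ (Fin 3))} {b : ℝ → (EuclideanSpace ℝ (Fin 3))}

/-- A coordinate of a field: `(DV(x)v)ᵢ = D(Vᵢ)(x)v`. [folklore] -/
private theorem fderiv_apply_coord_fin3 {V : (EuclideanSpace ℝ (Fin 3)) → (EuclideanSpace ℝ (Fin 3))} {x : (EuclideanSpace ℝ (Fin 3))} (hV : DifferentiableAt ℝ V x) (i : Fin 3)
    (v : (EuclideanSpace ℝ (Fin 3))) : fderiv ℝ V x v i = fderiv ℝ (fun y => V y i) x v := by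
  have h : HasFDerivAt (⇑(EuclideanSpace.proj (𝕜 := ℝ) i) ∘ V)
      ((EuclideanSpace.proj i).comp (fderiv ℝ V x)) x :=
    (EuclideanSpace.proj i).hasFDerivAt.comp x hV.hasFDerivAt
  have h' : HasFDerivAt (fun y => V y i) ((EuclideanSpace.proj i).comp (fderiv ℝ V x)) x := h
  rw [h'.fderiv]
  rfl

/-- `ℓ ∘ curl V = (ℓ ∘ curlCLM) ∘ DV` for a linear form `ℓ`. [folklore] -/
private theorem clm_curl_eq_comp (ℓ : (EuclideanSpace ℝ (Fin 3)) →L[ℝ] ℝ) (V : (EuclideanSpace ℝ (Fin 3)) → (EuclideanSpace ℝ (Fin 3))) :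
    (fun y => ℓ (curl V y)) = fun y => (ℓ.comp curlCLM) (fderiv ℝ V y) := by
  funext y
  rw [ContinuousLinearMap.comp_apply, ← curl_eq_curlCLM]

/-- **`ℓ(curl U(t))` is smooth, with all derivatives bounded and Lipschitz in `t`**, for a linear
form `ℓ` of norm `≤ 1` and a family as furnished by `KNSS2009_regularity_boundedWeak_ancient`
(the form `curl_apply_one_family` of `KNSSThm52Assembly` for an arbitrary linear form; KNSS 2009,
§4 (4.7)–(4.8) and Remark 5.1: the vorticity "is bounded with its derivatives"). [cite: KochNadirashviliSereginSverak2009, §4 (4.7)–(4.8) (arXiv p. 8) and Remark 5.1 (p. 9)] -/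
theorem clm_curl_family (ℓ : (EuclideanSpace ℝ (Fin 3)) →L[ℝ] ℝ) (hℓ : ‖ℓ‖ ≤ 1) (hsmooth : ∀ t < 0, ContDiff ℝ ∞ (U t))
    {C : ℕ → ℝ} (hC : ∀ k : ℕ, ∀ t < 0, ∀ x, ‖iteratedFDeriv ℝ k (U t) x‖ ≤ C k) {L : ℕ → ℝ}
    (hL : ∀ k : ℕ, 1 ≤ k → ∀ s < 0, ∀ t < 0, ∀ x,
      ‖iteratedFDeriv ℝ k (U t) x - iteratedFDeriv ℝ k (U s) x‖ ≤ L k * |t - s|) :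
    (∀ t < 0, ContDiff ℝ ∞ fun y => ℓ (curl (U t) y)) ∧
    (∀ n : ℕ, ∀ t < 0, ∀ y, ‖iteratedFDeriv ℝ n (fun y => ℓ (curl (U t) y)) y‖ ≤ ‖curlCLM‖ * C (n + 1)) ∧
    (∀ n : ℕ, ∀ s < 0, ∀ t < 0, ∀ y,
      ‖iteratedFDeriv ℝ n (fun y => ℓ (curl (U t) y)) y -
        iteratedFDeriv ℝ n (fun y => ℓ (curl (U s) y)) y‖ ≤ ‖curlCLM‖ * L (n + 1) * |t - s|) := by
  set Λ : ((EuclideanSpace ℝ (Fin 3)) →L[ℝ] (EuclideanSpace ℝ (Fin 3))) →L[ℝ] ℝ := ℓ.comp curlCLM with hΛ_def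
  have hΛ : ‖Λ‖ ≤ ‖curlCLM‖ := by
    refine (ContinuousLinearMap.opNorm_comp_le _ _).trans ?_
    calc _ ≤ 1 * ‖curlCLM‖ := mul_le_mul_of_nonneg_right hℓ (norm_nonneg curlCLM)
      _ = ‖curlCLM‖ := one_mul _
  have heq : ∀ t, (fun y => ℓ (curl (U t) y)) = fun y => Λ (fderiv ℝ (U t) y) := fun t =>
    clm_curl_eq_comp ℓ (U t)
  refine ⟨fun t ht => ?_, fun n t ht y => ?_, fun n s hs t ht y => ?_⟩
  · rw [heq]; exact Λ.contDiff.comp ((hsmooth t ht).fderiv_right (m := ∞) le_rfl)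
  · rw [heq]
    calc _ ≤ ‖Λ‖ * ‖iteratedFDeriv ℝ (n + 1) (U t) y‖ :=
          norm_iteratedFDeriv_clm_apply_fderiv_le Λ (hsmooth t ht) n y
      _ ≤ ‖curlCLM‖ * C (n + 1) :=
          mul_le_mul hΛ (hC (n + 1) t ht y) (norm_nonneg _) (norm_nonneg curlCLM)
  · rw [heq, heq]
    have hdiff : (fun y => Λ (fderiv ℝ (U t) y)) - (fun y => Λ (fderiv ℝ (U s) y)) =
        fun y => Λ (fderiv ℝ (U t - U s) y) := by
      funext y
      rw [Pi.sub_apply, fderiv_sub (((hsmooth t ht).differentiable (by simp)) y)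
        (((hsmooth s hs).differentiable (by simp)) y), map_sub]
    have hts : ContDiff ℝ ∞ (U t - U s) := (hsmooth t ht).sub (hsmooth s hs)
    have hct : ContDiff ℝ n (fun y => Λ (fderiv ℝ (U t) y)) :=
      (Λ.contDiff.comp ((hsmooth t ht).fderiv_right (m := ∞) le_rfl)).of_le (natCast_le_contDiff_infty n)
    have hcs : ContDiff ℝ n (fun y => Λ (fderiv ℝ (U s) y)) :=
      (Λ.contDiff.comp ((hsmooth s hs).fderiv_right (m := ∞) le_rfl)).of_le (natCast_le_contDiff_infty n)
    rw [← iteratedFDeriv_sub_apply hct.contDiffAt hcs.contDiffAt, hdiff]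
    calc _ ≤ ‖Λ‖ * ‖iteratedFDeriv ℝ (n + 1) (U t - U s) y‖ :=
          norm_iteratedFDeriv_clm_apply_fderiv_le Λ hts n y
      _ = ‖Λ‖ * ‖iteratedFDeriv ℝ (n + 1) (U t) y - iteratedFDeriv ℝ (n + 1) (U s) y‖ := by
          rw [iteratedFDeriv_sub_apply ((hsmooth t ht).of_le (natCast_le_contDiff_infty _)).contDiffAt
            ((hsmooth s hs).of_le (natCast_le_contDiff_infty _)).contDiffAt]
      _ ≤ ‖curlCLM‖ * (L (n + 1) * |t - s|) :=
          mul_le_mul hΛ (hL (n + 1) (by omega) s hs t ht y) (norm_nonneg _) (norm_nonneg curlCLM)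
      _ = ‖curlCLM‖ * L (n + 1) * |t - s| := by ring

/-- **A linear function `ℓ(curl U)` of the vorticity of the §4 representative that has no
stretching is `≤ 0` whenever it is a directional derivative of a bounded function.** Let `U, b`
carry the clauses of `KNSS2009_regularity_boundedWeak_ancient` (measurability, smooth slices with
all derivatives bounded and Lipschitz in `t`, the time-integrated vorticity equation (4.5) with
drift `U + b`), let `ℓ` be a linear form of norm `≤ 1` killing the velocity gradient
(`ℓ(DU(τ)(x)v) = 0`, so that the stretching term `ℓ(DU[ω])` vanishes), and suppose
`ℓ(curl U(t)) = ∂ₑ w_t` with `|w_t| ≤ C₀` at every `t < 0`. Then `ℓ(curl U) ≤ 0`: the scalar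
`ℓ(curl U)` lies in the class of Lemma 2.1 with drift `U + b` (bounds and joint continuity from
`clm_curl_family`, the equation from (4.5) through `ℓ`, the integrand being interval integrable by
`vorticity_integrand_intervalIntegrable`), and `directionalDeriv_nonpos_of_lemma21` applies. [cite: KochNadirashviliSereginSverak2009, §4 (4.5) p. 8 and proof of Thm 5.1 (p. 9)] -/
theorem clm_curl_nonpos (ℓ : (EuclideanSpace ℝ (Fin 3)) →L[ℝ] ℝ) (hℓ : ‖ℓ‖ ≤ 1) {e : (EuclideanSpace ℝ (Fin 3))} (he : ‖e‖ = 1)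
    (hbm : Measurable b) {Cb : ℝ} (hCb : ∀ t, ‖b t‖ ≤ Cb) (hUm : Measurable (uncurry U))
    (hsmooth : ∀ t < 0, ContDiff ℝ ∞ (U t)) {C : ℕ → ℝ}
    (hC : ∀ k : ℕ, ∀ t < 0, ∀ x, ‖iteratedFDeriv ℝ k (U t) x‖ ≤ C k) {L : ℕ → ℝ}
    (hL : ∀ k : ℕ, 1 ≤ k → ∀ s < 0, ∀ t < 0, ∀ x,
      ‖iteratedFDeriv ℝ k (U t) x - iteratedFDeriv ℝ k (U s) x‖ ≤ L k * |t - s|)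
    (hvort : ∀ x, ∀ s t : ℝ, s ≤ t → t < 0 →
      curl (U t) x - curl (U s) x =
        ∫ τ in s..t, ((Δ (curl (U τ))) x - fderiv ℝ (curl (U τ)) x (U τ x + b τ) +
          fderiv ℝ (U τ) x (curl (U τ) x)))
    (hkill : ∀ τ < 0, ∀ x v : (EuclideanSpace ℝ (Fin 3)), ℓ (fderiv ℝ (U τ) x v) = 0)
    (hrep : ∀ t < 0, ∃ w : (EuclideanSpace ℝ (Fin 3)) → ℝ, Differentiable ℝ w ∧ (∀ x, |w x| ≤ C 0) ∧
      ∀ x, ℓ (curl (U t) x) = fderiv ℝ w x e) :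
    ∀ t < 0, ∀ x, ℓ (curl (U t) x) ≤ 0 := by
  obtain ⟨hg, hgC, hgL⟩ := clm_curl_family ℓ hℓ hsmooth hC hL
  set g : ℝ → (EuclideanSpace ℝ (Fin 3)) → ℝ := fun t y => ℓ (curl (U t) y) with hg_def
  set a : ℝ → (EuclideanSpace ℝ (Fin 3)) → (EuclideanSpace ℝ (Fin 3)) := fun t y => U t y + b t with ha_def
  have ham : Measurable (uncurry a) := by
    have : uncurry a = fun p : ℝ × (EuclideanSpace ℝ (Fin 3)) => uncurry U p + b p.1 := by
      funext p; rfl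
    rw [this]
    exact hUm.add (hbm.comp measurable_fst)
  have haA : ∀ t < 0, ∀ y, ‖a t y‖ ≤ C 0 + Cb := fun t ht y => by
    have h0 := hC 0 t ht y
    rw [norm_iteratedFDeriv_zero] at h0
    exact (norm_add_le _ _).trans (add_le_add h0 (hCb t))
  have hg2 : ∀ t < 0, ContDiff ℝ 2 (g t) := fun t ht => (hg t ht).of_le (by norm_cast)
  have hg1 : ∀ t < 0, ContDiff ℝ 1 (g t) := fun t ht => (hg t ht).of_le (by norm_cast)
  have hgb : ∃ C' : ℝ, ∀ t < 0, ∀ y, |g t y| ≤ C' := ⟨‖curlCLM‖ * C 1, fun t ht y => by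
    have h := hgC 0 t ht y
    rwa [norm_iteratedFDeriv_zero, Real.norm_eq_abs] at h⟩
  have hgD : ∀ t < 0, ∀ y, ‖fderiv ℝ (g t) y‖ ≤ ‖curlCLM‖ * C 2 := fun t ht y => by
    rw [norm_fderiv_eq_norm_iteratedFDeriv_one]; exact hgC 1 t ht y
  have hgΔ : ∀ t < 0, ∀ y, |(Δ (g t)) y| ≤ 3 * (‖curlCLM‖ * C 3) := fun t ht y => by
    have h := norm_iteratedFDeriv_laplacian_le (hg t ht) 0 y
    rw [norm_iteratedFDeriv_zero, Real.norm_eq_abs, finrank_euclideanSpace_fin] at h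
    refine h.trans ?_
    push_cast
    exact mul_le_mul_of_nonneg_left (hgC 2 t ht y) (by norm_num)
  have hfD : ∃ C' : ℝ, ∀ t < 0, ∀ y, ‖fderiv ℝ (g t) y‖ ≤ C' ∧ |(Δ (g t)) y| ≤ C' :=
    ⟨max (‖curlCLM‖ * C 2) (3 * (‖curlCLM‖ * C 3)), fun t ht y =>
      ⟨(hgD t ht y).trans (le_max_left _ _), (hgΔ t ht y).trans (le_max_right _ _)⟩⟩
  -- time-Lipschitz bounds for `Dg` and `Δg`, hence joint continuity
  have hDlip : ∀ s ∈ Iio (0 : ℝ), ∀ t ∈ Iio (0 : ℝ), ∀ y,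
      ‖fderiv ℝ (g t) y - fderiv ℝ (g s) y‖ ≤ ‖curlCLM‖ * L 2 * |t - s| := by
    intro s hs t ht y
    have hs' : s < 0 := hs
    have ht' : t < 0 := ht
    have e1 : fderiv ℝ (g t) y - fderiv ℝ (g s) y = fderiv ℝ (g t - g s) y :=
      (fderiv_sub (((hg1 t ht').differentiable one_ne_zero) y)
        (((hg1 s hs').differentiable one_ne_zero) y)).symm
    rw [e1, norm_fderiv_eq_norm_iteratedFDeriv_one,
      iteratedFDeriv_sub_apply ((hg t ht').of_le (natCast_le_contDiff_infty 1)).contDiffAt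
        ((hg s hs').of_le (natCast_le_contDiff_infty 1)).contDiffAt]
    exact hgL 1 s hs' t ht' y
  have hΔlip : ∀ s ∈ Iio (0 : ℝ), ∀ t ∈ Iio (0 : ℝ), ∀ y,
      ‖(Δ (g t)) y - (Δ (g s)) y‖ ≤ 3 * ‖curlCLM‖ * L 3 * |t - s| := by
    intro s hs t ht y
    have hs' : s < 0 := hs
    have ht' : t < 0 := ht
    rw [← (hg2 t ht').contDiffAt.laplacian_sub (hg2 s hs').contDiffAt]
    have hsub : ContDiff ℝ ∞ (g t - g s) := (hg t ht').sub (hg s hs')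
    have h := norm_iteratedFDeriv_laplacian_le hsub 0 y
    rw [norm_iteratedFDeriv_zero, finrank_euclideanSpace_fin] at h
    have h2 : ‖iteratedFDeriv ℝ 2 (g t - g s) y‖ ≤ ‖curlCLM‖ * L 3 * |t - s| := by
      rw [iteratedFDeriv_sub_apply ((hg t ht').of_le (natCast_le_contDiff_infty 2)).contDiffAt
        ((hg s hs').of_le (natCast_le_contDiff_infty 2)).contDiffAt]
      exact hgL 2 s hs' t ht' y
    refine h.trans ?_
    push_cast
    calc (3 : ℝ) * ‖iteratedFDeriv ℝ 2 (g t - g s) y‖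
        ≤ 3 * (‖curlCLM‖ * L 3 * |t - s|) := mul_le_mul_of_nonneg_left h2 (by norm_num)
      _ = 3 * ‖curlCLM‖ * L 3 * |t - s| := by ring
  have hcD : ContinuousOn (fun p : ℝ × (EuclideanSpace ℝ (Fin 3)) => fderiv ℝ (g p.1) p.2) (Iio 0 ×ˢ univ) :=
    continuousOn_prod_of_lipschitz_time (ψ := fun t y => fderiv ℝ (g t) y) hDlip
      fun t ht => (hg1 t ht).continuous_fderiv one_ne_zero
  have hcΔ : ContinuousOn (fun p : ℝ × (EuclideanSpace ℝ (Fin 3)) => (Δ (g p.1)) p.2) (Iio 0 ×ˢ univ) :=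
    continuousOn_prod_of_lipschitz_time (ψ := fun t y => (Δ (g t)) y) hΔlip
      fun t ht => continuous_laplacian (hg2 t ht)
  -- the equation: (4.5) through `ℓ`, the stretching term killed by `hkill`
  have heq : ∀ y, ∀ s t : ℝ, s ≤ t → t < 0 →
      g t y - g s y = ∫ τ in s..t, ((Δ (g τ)) y - fderiv ℝ (g τ) y (a τ y)) := by
    intro y s t hst ht
    have hint := vorticity_integrand_intervalIntegrable hsmooth hC hL hUm hbm hCb y hst ht
    have h1 : g t y - g s y = ℓ (curl (U t) y - curl (U s) y) := by
      simp only [hg_def, map_sub]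
    rw [h1, hvort y s t hst ht, ← ℓ.intervalIntegral_comp_comm hint]
    refine intervalIntegral.integral_congr fun τ hτ => ?_
    have hτ0 : τ < 0 := by
      rw [uIcc_of_le hst] at hτ
      exact hτ.2.trans_lt ht
    have hcurl2 : ContDiff ℝ 2 (curl (U τ)) :=
      contDiff_curl (n := 2) ((hsmooth τ hτ0).of_le (by norm_cast))
    have eΔ : ℓ ((Δ (curl (U τ))) y) = (Δ (g τ)) y := by
      have h := hcurl2.contDiffAt.laplacian_CLM_comp_left (l := ℓ) (x := y)
      rw [Function.comp_apply] at h
      exact h.symm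
    have eD : ∀ v, ℓ (fderiv ℝ (curl (U τ)) y v) = fderiv ℝ (g τ) y v := by
      intro v
      have hd : DifferentiableAt ℝ (curl (U τ)) y := (hcurl2.differentiable two_ne_zero) y
      have hc : HasFDerivAt (⇑ℓ ∘ curl (U τ)) (ℓ.comp (fderiv ℝ (curl (U τ)) y)) y :=
        ℓ.hasFDerivAt.comp y hd.hasFDerivAt
      have hc' : HasFDerivAt (g τ) (ℓ.comp (fderiv ℝ (curl (U τ)) y)) y := hc
      rw [hc'.fderiv]
      rfl
    have hsplit : ℓ ((Δ (curl (U τ))) y - fderiv ℝ (curl (U τ)) y (U τ y + b τ) +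
          fderiv ℝ (U τ) y (curl (U τ) y)) =
        ℓ ((Δ (curl (U τ))) y) - ℓ (fderiv ℝ (curl (U τ)) y (U τ y + b τ)) +
          ℓ (fderiv ℝ (U τ) y (curl (U τ) y)) := by
      rw [ℓ.map_add, ℓ.map_sub]
    rw [hsplit, eΔ, eD, hkill τ hτ0, add_zero]
  exact directionalDeriv_nonpos_of_lemma21 he ham haA hgb hg2 hfD hcD hcΔ heq hrep

/-- **The §4 representative of a solution with constant planar components is constant in
space.** Let `U, b` carry the clauses of `KNSS2009_regularity_boundedWeak_ancient` (as in
`clm_curl_nonpos`, plus `div U(t) = 0`), and suppose the planar components `U₀(t, ·)`,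
`U₂(t, ·)` are constant in space at every `t < 0`. Then `U(t, ·)` is constant in space at every
`t < 0`: the vorticity is `ω = (−∂₂U₁, 0, ∂₀U₁)`, the linear forms `±ω₀`, `±ω₂` kill the
velocity gradient in the stretching term, and each is a directional derivative (`∂₂` resp. `∂₀`)
of the bounded function `∓U₁` resp. `±U₁`; so `∂₀U₁ = ∂₂U₁ = 0` by `clm_curl_nonpos`, and
`∂₁U₁ = −∂₀U₀ − ∂₂U₂ = 0` by incompressibility. [cite: KochNadirashviliSereginSverak2009, proof of Thm 5.1 (arXiv p. 9) and of Thm 6.2 (p. 13)] -/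
theorem repr_const_of_planar_const (hbm : Measurable b) (hbC : ∃ C : ℝ, ∀ t, ‖b t‖ ≤ C)
    (hUm : Measurable (uncurry U)) (hsmooth : ∀ t < 0, ContDiff ℝ ∞ (U t))
    (hdivU : ∀ t < 0, VectorCalculus.IsDivFree (U t))
    (hbd : ∀ k : ℕ, ∃ C : ℝ, ∀ t < 0, ∀ x, ‖iteratedFDeriv ℝ k (U t) x‖ ≤ C)
    (hlip : ∀ k : ℕ, 1 ≤ k → ∃ L : ℝ, ∀ s < 0, ∀ t < 0, ∀ x,
      ‖iteratedFDeriv ℝ k (U t) x - iteratedFDeriv ℝ k (U s) x‖ ≤ L * |t - s|)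
    (hvort : ∀ x, ∀ s t : ℝ, s ≤ t → t < 0 →
      curl (U t) x - curl (U s) x =
        ∫ τ in s..t, ((Δ (curl (U τ))) x - fderiv ℝ (curl (U τ)) x (U τ x + b τ) +
          fderiv ℝ (U τ) x (curl (U τ) x)))
    (hpl : ∀ t < 0, ∀ x : (EuclideanSpace ℝ (Fin 3)), U t x 0 = U t 0 0 ∧ U t x 2 = U t 0 2) :
    ∀ t < 0, ∀ x : (EuclideanSpace ℝ (Fin 3)), U t x = U t 0 := by
  choose C hC using hbd
  have hlip' : ∀ k : ℕ, ∃ L : ℝ, 1 ≤ k → ∀ s < 0, ∀ t < 0, ∀ x,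
      ‖iteratedFDeriv ℝ k (U t) x - iteratedFDeriv ℝ k (U s) x‖ ≤ L * |t - s| := by
    intro k
    by_cases hk : 1 ≤ k
    · obtain ⟨L, hL⟩ := hlip k hk
      exact ⟨L, fun _ => hL⟩
    · exact ⟨0, fun h => absurd h hk⟩
  choose L hL using hlip'
  obtain ⟨Cb, hCb⟩ := hbC
  have hdiff : ∀ t < 0, Differentiable ℝ (U t) := fun t ht =>
    (hsmooth t ht).differentiable (by simp)
  -- the planar components have zero gradient
  have hD0 : ∀ t < 0, ∀ x v : (EuclideanSpace ℝ (Fin 3)), fderiv ℝ (U t) x v 0 = 0 := by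
    intro t ht x v
    rw [fderiv_apply_coord_fin3 (hdiff t ht x)]
    have : (fun y => U t y 0) = fun _ => U t 0 0 := funext fun y => (hpl t ht y).1
    rw [this, fderiv_const_apply]
    rfl
  have hD2 : ∀ t < 0, ∀ x v : (EuclideanSpace ℝ (Fin 3)), fderiv ℝ (U t) x v 2 = 0 := by
    intro t ht x v
    rw [fderiv_apply_coord_fin3 (hdiff t ht x)]
    have : (fun y => U t y 2) = fun _ => U t 0 2 := funext fun y => (hpl t ht y).2
    rw [this, fderiv_const_apply]
    rfl
  -- the bounded axial component `w = U₁`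
  have hw : ∀ t < 0, Differentiable ℝ fun y => U t y 1 := fun t ht =>
    (EuclideanSpace.proj (1 : Fin 3) : (EuclideanSpace ℝ (Fin 3)) →L[ℝ] ℝ).differentiable.comp (hdiff t ht)
  have hwb : ∀ t < 0, ∀ x, |U t x 1| ≤ C 0 := fun t ht x => by
    have h := hC 0 t ht x
    rw [norm_iteratedFDeriv_zero] at h
    have h1 : ‖U t x 1‖ ≤ ‖U t x‖ := PiLp.norm_apply_le (U t x) 1
    rw [Real.norm_eq_abs] at h1
    exact h1.trans h
  have he0 : ‖(EuclideanSpace.single 0 (1 : ℝ) : (EuclideanSpace ℝ (Fin 3)))‖ = 1 := by simp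
  have he2 : ‖(EuclideanSpace.single 2 (1 : ℝ) : (EuclideanSpace ℝ (Fin 3)))‖ = 1 := by simp
  -- the vorticity components in terms of `∂U₁`
  have hc2 : ∀ t < 0, ∀ x, curl (U t) x 2 =
      fderiv ℝ (fun y => U t y 1) x (EuclideanSpace.single 0 1) := by
    intro t ht x
    have : curl (U t) x 2 = fderiv ℝ (U t) x (EuclideanSpace.single 0 1) 1 -
        fderiv ℝ (U t) x (EuclideanSpace.single 1 1) 0 := by
      simp [curl]
    rw [this, hD0 t ht, sub_zero, fderiv_apply_coord_fin3 (hdiff t ht x)]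
  have hc0 : ∀ t < 0, ∀ x, curl (U t) x 0 =
      -fderiv ℝ (fun y => U t y 1) x (EuclideanSpace.single 2 1) := by
    intro t ht x
    have : curl (U t) x 0 = fderiv ℝ (U t) x (EuclideanSpace.single 1 1) 2 -
        fderiv ℝ (U t) x (EuclideanSpace.single 2 1) 1 := by
      simp [curl]
    rw [this, hD2 t ht, zero_sub, fderiv_apply_coord_fin3 (hdiff t ht x)]
  -- the four linear forms `± proj 2`, `± proj 0`
  have nP : ∀ i : Fin 3, ‖(EuclideanSpace.proj i : (EuclideanSpace ℝ (Fin 3)) →L[ℝ] ℝ)‖ ≤ 1 := fun i =>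
    ContinuousLinearMap.opNorm_le_bound _ zero_le_one fun v => by
      rw [one_mul]; simpa using PiLp.norm_apply_le v i
  have nPn : ∀ i : Fin 3, ‖-(EuclideanSpace.proj i : (EuclideanSpace ℝ (Fin 3)) →L[ℝ] ℝ)‖ ≤ 1 := fun i => by
    rw [norm_neg]; exact nP i
  have kill2 : ∀ τ < 0, ∀ x v : (EuclideanSpace ℝ (Fin 3)),
      (EuclideanSpace.proj (2 : Fin 3) : (EuclideanSpace ℝ (Fin 3)) →L[ℝ] ℝ) (fderiv ℝ (U τ) x v) = 0 :=
    fun τ hτ x v => hD2 τ hτ x v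
  have kill0 : ∀ τ < 0, ∀ x v : (EuclideanSpace ℝ (Fin 3)),
      (EuclideanSpace.proj (0 : Fin 3) : (EuclideanSpace ℝ (Fin 3)) →L[ℝ] ℝ) (fderiv ℝ (U τ) x v) = 0 :=
    fun τ hτ x v => hD0 τ hτ x v
  have kill2n : ∀ τ < 0, ∀ x v : (EuclideanSpace ℝ (Fin 3)),
      (-(EuclideanSpace.proj (2 : Fin 3) : (EuclideanSpace ℝ (Fin 3)) →L[ℝ] ℝ)) (fderiv ℝ (U τ) x v) = 0 :=
    fun τ hτ x v => by rw [neg_apply, kill2 τ hτ x v, neg_zero]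
  have kill0n : ∀ τ < 0, ∀ x v : (EuclideanSpace ℝ (Fin 3)),
      (-(EuclideanSpace.proj (0 : Fin 3) : (EuclideanSpace ℝ (Fin 3)) →L[ℝ] ℝ)) (fderiv ℝ (U τ) x v) = 0 :=
    fun τ hτ x v => by rw [neg_apply, kill0 τ hτ x v, neg_zero]
  -- the representations as directional derivatives of `± U₁`
  have rep2 : ∀ t < 0, ∃ w : (EuclideanSpace ℝ (Fin 3)) → ℝ, Differentiable ℝ w ∧ (∀ x, |w x| ≤ C 0) ∧
      ∀ x, (EuclideanSpace.proj (2 : Fin 3) : (EuclideanSpace ℝ (Fin 3)) →L[ℝ] ℝ) (curl (U t) x) =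
        fderiv ℝ w x (EuclideanSpace.single 0 1) :=
    fun t ht => ⟨fun y => U t y 1, hw t ht, hwb t ht, fun x => hc2 t ht x⟩
  have rep2n : ∀ t < 0, ∃ w : (EuclideanSpace ℝ (Fin 3)) → ℝ, Differentiable ℝ w ∧ (∀ x, |w x| ≤ C 0) ∧
      ∀ x, (-(EuclideanSpace.proj (2 : Fin 3) : (EuclideanSpace ℝ (Fin 3)) →L[ℝ] ℝ)) (curl (U t) x) =
        fderiv ℝ w x (EuclideanSpace.single 0 1) :=
    fun t ht => ⟨fun y => -U t y 1, (hw t ht).neg, fun x => by rw [abs_neg]; exact hwb t ht x,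
      fun x => by
        rw [neg_apply, fderiv_fun_neg, neg_apply, ← hc2 t ht x]
        rfl⟩
  have rep0 : ∀ t < 0, ∃ w : (EuclideanSpace ℝ (Fin 3)) → ℝ, Differentiable ℝ w ∧ (∀ x, |w x| ≤ C 0) ∧
      ∀ x, (EuclideanSpace.proj (0 : Fin 3) : (EuclideanSpace ℝ (Fin 3)) →L[ℝ] ℝ) (curl (U t) x) =
        fderiv ℝ w x (EuclideanSpace.single 2 1) :=
    fun t ht => ⟨fun y => -U t y 1, (hw t ht).neg, fun x => by rw [abs_neg]; exact hwb t ht x,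
      fun x => by
        rw [fderiv_fun_neg, neg_apply, ← hc0 t ht x]
        rfl⟩
  have rep0n : ∀ t < 0, ∃ w : (EuclideanSpace ℝ (Fin 3)) → ℝ, Differentiable ℝ w ∧ (∀ x, |w x| ≤ C 0) ∧
      ∀ x, (-(EuclideanSpace.proj (0 : Fin 3) : (EuclideanSpace ℝ (Fin 3)) →L[ℝ] ℝ)) (curl (U t) x) =
        fderiv ℝ w x (EuclideanSpace.single 2 1) :=
    fun t ht => ⟨fun y => U t y 1, hw t ht, hwb t ht, fun x => by
        rw [neg_apply, show (EuclideanSpace.proj (0 : Fin 3) : (EuclideanSpace ℝ (Fin 3)) →L[ℝ] ℝ)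
          (curl (U t) x) = curl (U t) x 0 from rfl, hc0 t ht x, neg_neg]⟩
  -- Lemma 2.1 four times
  have A2 := clm_curl_nonpos _ (nP 2) he0 hbm hCb hUm hsmooth hC hL hvort kill2 rep2
  have A2n := clm_curl_nonpos _ (nPn 2) he0 hbm hCb hUm hsmooth hC hL hvort kill2n rep2n
  have A0 := clm_curl_nonpos _ (nP 0) he2 hbm hCb hUm hsmooth hC hL hvort kill0 rep0
  have A0n := clm_curl_nonpos _ (nPn 0) he2 hbm hCb hUm hsmooth hC hL hvort kill0n rep0n
  -- hence `∂₀U₁ = ∂₂U₁ = 0`, and `∂₁U₁ = 0` by incompressibility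
  have d0 : ∀ t < 0, ∀ x, fderiv ℝ (fun y => U t y 1) x (EuclideanSpace.single 0 1) = 0 := by
    intro t ht x
    have h1 : curl (U t) x 2 ≤ 0 := A2 t ht x
    have h2 : -(curl (U t) x 2) ≤ 0 := A2n t ht x
    rw [← hc2 t ht x]
    linarith
  have d2 : ∀ t < 0, ∀ x, fderiv ℝ (fun y => U t y 1) x (EuclideanSpace.single 2 1) = 0 := by
    intro t ht x
    have h1 : curl (U t) x 0 ≤ 0 := A0 t ht x
    have h2 : -(curl (U t) x 0) ≤ 0 := A0n t ht x
    have h3 := hc0 t ht x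
    linarith
  have d1 : ∀ t < 0, ∀ x, fderiv ℝ (fun y => U t y 1) x (EuclideanSpace.single 1 1) = 0 := by
    intro t ht x
    have h := hdivU t ht x
    rw [divergence_eq_sum_inner_fderiv (EuclideanSpace.basisFun (Fin 3) ℝ)] at h
    simp only [EuclideanSpace.basisFun_apply, EuclideanSpace.inner_single_left, map_one, one_mul,
      Fin.sum_univ_three] at h
    rw [hD0 t ht, hD2 t ht, zero_add, add_zero] at h
    rw [← fderiv_apply_coord_fin3 (hdiff t ht x)]
    exact h
  have hfd : ∀ t < 0, ∀ x, fderiv ℝ (fun y => U t y 1) x = 0 := by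
    intro t ht x
    ext v
    have hv : v = ∑ j, v j • EuclideanSpace.single j (1 : ℝ) := by
      ext i; fin_cases i <;> simp [Fin.sum_univ_three]
    rw [hv, map_sum]
    simp only [map_smul, Fin.sum_univ_three, d0 t ht x, d1 t ht x, d2 t ht x, smul_zero, add_zero,
      zero_apply]
  have hU1 : ∀ t < 0, ∀ x, U t x 1 = U t 0 1 := fun t ht x =>
    is_const_of_fderiv_eq_zero (hw t ht) (hfd t ht) x 0
  intro t ht x
  ext i
  fin_cases i
  · exact (hpl t ht x).1
  · exact hU1 t ht x
  · exact (hpl t ht x).2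

end Representative

end Literature.Analysis.FluidPDE

end
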